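import Summits.HubbardSuperconductivity.HubbardSuperconductivity.Theorems.AnisotropyChordXXZWeightedHopping
import Summits.HubbardSuperconductivity.HubbardSuperconductivity.Theorems.AnisotropyChordTwoMagnonCoordinates

/-!
# Route `AnisotropyChord`: the bond-weighted XXZ Hamiltonian on two-magnon (pair) configurations

Second layer of the weighted toolkit (after `…XXZWeightedHopping`): the action of
`H = xxzHamiltonianWith 1 G J Δ` on a pair configuration `e_i + e_j` (`i ≠ j`) of a finite simple
graph with bond couplings `J : Sym2 V → ℝ`,

  `(Hψ)(e_i + e_j) = Δ·(Σ_{e ∈ E} J_e ζ_e(i,j))·ψ(e_i + e_j)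
      + ¼ Σ_x Σ_y [x ∼ y][exactly one of x, y ∈ {i,j}] J_{xy} ψ(e_{s i} + e_{s j})`, `s = swap_{xy}`,

with the pair Ising weight `ζ_{xy}(i,j) = −¼` if exactly one of `x, y` lies in `{i, j}` and `+¼`
otherwise (`pair_isingFactor`, `xxzWith_mulVec_pair`).  This is the weighted form of
`TwoMagnon.xxz_mulVec_pair` (constant `J = −1`), i.e. the position-space two-body equation behind
the theory seat's punctured problem on weighted graphs (THEOREM R on rook graphs with direction
weights, two-ring tori).  H. Tasaki (2020) §2.4.  No definition is introduced.
-/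

set_option linter.dupNamespace false

noncomputable section

namespace Summit.HubbardSuperconductivity.HubbardSuperconductivity.Theorems.AnisotropyChord.Weighted

open Matrix Complex Finset
open Literature.MathematicalPhysics.QuantumLattice
open Summit.HubbardSuperconductivity.HubbardSuperconductivity.Theorems.AnisotropyChord.TwoMagnon
  (pair_apply pair_apply_ne_iff pair_comp_swap sum_edgeFinset_lift_eq_half)

variable {V : Type*} [Fintype V] [DecidableEq V]

omit [Fintype V] in
/-- **Ising factor of a pair configuration on a bond** (`i ≠ j`):
`(½ − (e_i+e_j)_x)(½ − (e_i+e_j)_y) = −¼` if exactly one of `x, y` lies in `{i, j}`, `+¼` otherwise.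
[folklore] -/
theorem pair_isingFactor {i j : V} (hij : i ≠ j) (x y : V) :
    ((1 : ℝ) / 2 - ((Pi.single i (1 : Fin 2) + Pi.single j 1 : V → Fin 2) x : ℕ)) *
        ((1 : ℝ) / 2 - ((Pi.single i (1 : Fin 2) + Pi.single j 1 : V → Fin 2) y : ℕ)) =
      if ((x = i ∨ x = j) ∧ ¬ (y = i ∨ y = j) ∨ ¬ (x = i ∨ x = j) ∧ (y = i ∨ y = j)) then -(1 / 4)
      else 1 / 4 := by
  rw [pair_apply hij, pair_apply hij]
  by_cases hx : x = i ∨ x = j <;> by_cases hy : y = i ∨ y = j <;> simp [hx, hy] <;> norm_num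

variable (G : SimpleGraph V) [DecidableRel G.Adj]

/-- A weighted edge sum of a symmetric function is half the weighted ordered-pair sum:
`Σ_e J_e F(e) = ½ Σ_x Σ_y [x∼y] J_{xy} F(x,y)`. [folklore] -/
theorem sum_edgeFinset_weight_mul_lift_eq_half {M : Type*} [Field M] [CharZero M] (w : Sym2 V → M)
    (F : V → V → M) (hF : ∀ x y, F x y = F y x) :
    ∑ e ∈ G.edgeFinset, w e * Sym2.lift ⟨F, hF⟩ e =
      (1 / 2) * ∑ x, ∑ y, (if G.Adj x y then w s(x, y) * F x y else 0) := by
  have h := sum_edgeFinset_lift_eq_half G (fun x y => w s(x, y) * F x y)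
    (fun x y => by rw [hF x y, Sym2.eq_swap])
  rw [← h]
  refine Finset.sum_congr rfl fun e _ => ?_
  induction e using Sym2.ind with
  | h x y => simp only [Sym2.lift_mk]

/-- **The weighted `H(Δ)` on a pair configuration in pair coordinates** (`i ≠ j`):
`(Hψ)(e_i+e_j) = Δ·(Σ_e J_e ζ_e(i,j))·ψ(e_i+e_j) + ¼ Σ_x Σ_y [x∼y][exactly one of x,y ∈ {i,j}]
J_{xy} ψ(e_{s i} + e_{s j})`, `s = swap_{xy}`, `ζ` the pair Ising factor (`pair_isingFactor`).
Weighted twin of `TwoMagnon.xxz_mulVec_pair`. Tasaki (2020) §2.4. [folklore] -/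
theorem xxzWith_mulVec_pair (J : Sym2 V → ℝ) (Δ : ℝ) (ψ : (V → Fin 2) → ℂ) {i j : V} (hij : i ≠ j) :
    ((xxzHamiltonianWith 1 G J Δ : Op V 2) *ᵥ ψ) (Pi.single i 1 + Pi.single j 1) =
      ((Δ * ∑ e ∈ G.edgeFinset, J e * Sym2.lift ⟨fun x y =>
          if ((x = i ∨ x = j) ∧ ¬ (y = i ∨ y = j) ∨ ¬ (x = i ∨ x = j) ∧ (y = i ∨ y = j))
          then -((1 : ℝ) / 4) else 1 / 4, fun x y => by
            by_cases hx : x = i ∨ x = j <;> by_cases hy : y = i ∨ y = j <;> simp [hx, hy]⟩ e : ℝ) : ℂ) *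
          ψ (Pi.single i 1 + Pi.single j 1)
        + (1 / 4 : ℂ) * ∑ x, ∑ y, (if G.Adj x y then
            (if ((x = i ∨ x = j) ∧ ¬ (y = i ∨ y = j) ∨ ¬ (x = i ∨ x = j) ∧ (y = i ∨ y = j)) then
              (J s(x, y) : ℂ) * ψ (Pi.single (Equiv.swap x y i) 1 + Pi.single (Equiv.swap x y j) 1)
            else 0) else 0) := by
  rw [xxzWith_mulVec_apply G J Δ ψ]
  congr 1
  · -- the Ising diagonal, bond by bond
    congr 1
    push_cast
    congr 1
    refine Finset.sum_congr rfl fun e he => ?_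
    revert he
    induction e using Sym2.ind with
    | h x y =>
      intro he
      rw [SimpleGraph.mem_edgeFinset, SimpleGraph.mem_edgeSet] at he
      simp only [Sym2.lift_mk]
      rw [pair_isingFactor hij x y]
  · -- the hops: weighted edge sum → ordered pairs
    rw [sum_edgeFinset_weight_mul_lift_eq_half G (fun e => (J e : ℂ))]
    rw [← mul_assoc]
    congr 1
    · norm_num
    · refine Finset.sum_congr rfl fun x _ => Finset.sum_congr rfl fun y _ => ?_
      by_cases hadj : G.Adj x y
      · rw [if_pos hadj, if_pos hadj]
        by_cases hc : ((x = i ∨ x = j) ∧ ¬ (y = i ∨ y = j) ∨ ¬ (x = i ∨ x = j) ∧ (y = i ∨ y = j))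
        · rw [if_pos ((pair_apply_ne_iff hij x y).mpr hc), if_pos hc, pair_comp_swap]
        · rw [if_neg (fun h => hc ((pair_apply_ne_iff hij x y).mp h)), if_neg hc, mul_zero]
      · rw [if_neg hadj, if_neg hadj]

end Summit.HubbardSuperconductivity.HubbardSuperconductivity.Theorems.AnisotropyChord.Weighted
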